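/-
Copyright (c) 2026. All rights reserved.
Released under Apache 2.0 license as described in the file LICENSE.
Authors: hodgecm-mathlib cell (D-0151), fan A, seat A-p10.
-/
import Literature.NumberTheory.Automorphic.UnitaryGroupHermitianSphereTransitive
import HarnessLib

/-!
# Transitivity of `U(σ, H)` on the punctured isotropic cone `{x ≠ 0 : h(x,x) = 0}` of a non-degenerate hermitian space
# (Witt's theorem for isotropic lines)

Topic `NumberTheory/Automorphic`; namespace `Literature.NumberTheory.Automorphic.UnitaryGroup` (continues
`UnitaryGroupHermitianSphereTransitive`: quasi-reflections along arbitrary vectors, transitivity on the non-isotropic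
level sets; and `UnitaryGroupIsotropicLineElements`: hyperbolic partners `exists_hyperbolic_partner_hermForm`, the Levi
dilations `lineDilationGL` of a hyperbolic pair).  KERNEL ONLY: theorems; no definition, no named fact, no instance,
no `sorry`.

SETTING.  `K` a field with `2 ≠ 0`, `σ : K →+* K` an involution, `H ∈ Mₙ(K)` `σ`-hermitian and NON-DEGENERATE
(`det H ≠ 0`), `h = hermForm σ H`, `U(σ, H) = unitaryGroupOfForm σ H ≤ GLₙ(K)`.

* §1 **scaling an isotropic vector**: for `x ≠ 0` isotropic and `c ≠ 0` some `g ∈ U(σ, H)` has `g x = c • x` — the Levi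
  dilation `D(c, (σ c)⁻¹)` of a hyperbolic pair `(x, x')` (`exists_mem_unitaryGroupOfForm_mulVec_eq_smul_of_isotropic`).
* §2 **two isotropic vectors that pair non-trivially are conjugate**: `h(x,x) = h(y,y) = 0`, `h(x,y) ≠ 0` ⇒ `g x = y` for
  some `g ∈ U(σ,H)` — one quasi-reflection `x ↦ y₁ := h(x,y)⁻¹ • y` (Dieudonné's relation is automatic:
  `h(x − y₁, x) = −1`) followed by the dilation `y₁ ↦ h(x,y) • y₁ = y`
  (`exists_mem_unitaryGroupOfForm_mulVec_eq_of_isotropic_of_ne_zero`).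
* §3 **a common non-orthogonal isotropic vector**: for non-zero isotropic `x ⊥ y` there is an isotropic `z` with
  `h(x,z) ≠ 0` and `h(y,z) ≠ 0` (`exists_isotropic_not_orth_not_orth`: `z₀ = x' + μ y'` from hyperbolic partners with
  `μ ∈ {0, 1, −1}` avoiding two bad values, then `z = z₀ − (h(z₀,z₀) ∕ 2 σ h(x,z₀)) • x`).
* §4 **TRANSITIVITY ON THE PUNCTURED ISOTROPIC CONE**: **`exists_mem_unitaryGroupOfForm_mulVec_eq_of_isotropic`** — for
  non-zero isotropic `x, y` some `g ∈ U(σ, H)` has `g x = y` (§2 directly, or through the `z` of §3 in two steps); with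
  `UnitaryGroupHermitianSphereTransitive.exists_mem_unitaryGroupOfForm_mulVec_eq` this gives the ALL-LEVELS form
  **`exists_mem_unitaryGroupOfForm_mulVec_eq_of_ne_zero`**: `x, y ≠ 0`, `h(x,x) = h(y,y)` ⇒ `U(σ,H) x ∋ y` — Witt's
  theorem for LINES of a non-degenerate hermitian space ([Dieudonne1971GroupesClassiques, Chap. II §4 n° 7–8];
  [Scharlau1985HermitianForms, Ch. 7 §9]).

USE (cell `hodgecm-mathlib`, FLOOR-0 P4, ENGINE E-2 child `Cruxes/H413/Lines/F0_E2SiegelWeilWeilRange.lean`, stub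
`stub_SW2_siegelWeil`, IDENTITY road = [Weil1965, Thm. 5] at rank one): Weil's hypothesis «`v` une place telle que
`U(0)_v` ne soit pas vide, et `G'_v ⊂ G_v` qui opère transitivement sur `U(i)_v` quel que soit `i`» at the auxiliary
place `v` — for `G'_v = G_v = U(V)(E_v)` and `n = 1` the sets `U(i)_v` are the level sets `{x ≠ 0 : h(x,x) = i}` of
`V ⊗ E_v`, and transitivity for EVERY `i` (including `i = 0`) is `exists_mem_unitaryGroupOfForm_mulVec_eq_of_ne_zero`
over `K = E_v` (an étale algebra at split `v` is not a field: there take `v` inert or ramified, or read the split place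
through `GL₃`).  HC_CM is proved only modulo the printed citations until rung 0 closes.

## References
* [Dieudonne1971GroupesClassiques] J. Dieudonné, *La géométrie des groupes classiques*, 3e éd. (1971), Chap. II §4
  n° 7–8, §5.
* [Scharlau1985HermitianForms] W. Scharlau, *Quadratic and Hermitian Forms*, Grundlehren 270 (1985), Ch. 7 §9.
* [Weil1965] A. Weil, Acta Math. 113 (1965) 1–87, n° 51–52 (Thm. 5).
-/

set_option autoImplicit false

noncomputable section

namespace Literature.NumberTheory.Automorphic.UnitaryGroup

open _root_.Matrix

variable {K : Type*} [Field K] (σ : K →+* K) {n : Type*} [Fintype n] [DecidableEq n] (H : Matrix n n K)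

/-! ## §1 Scaling an isotropic vector by a Levi dilation -/

/-- **scaling a non-zero isotropic vector**: `h(x,x) = 0`, `x ≠ 0`, `c ≠ 0` ⇒ `g x = c • x` for some `g ∈ U(σ, H)` (the
dilation `D(c, (σ c)⁻¹)` of a hyperbolic pair `(x, x')`; `H` non-degenerate, `2 ≠ 0`).
[cite: Dieudonne1971GroupesClassiques, Chap. II §5] -/
theorem exists_mem_unitaryGroupOfForm_mulVec_eq_smul_of_isotropic (h2 : (2 : K) ≠ 0) (hσ : ∀ s, σ (σ s) = s)
    (hH : (H.map σ)ᵀ = H) (hHd : H.det ≠ 0) {x : n → K} (hx : hermForm σ H x x = 0) (hx0 : x ≠ 0) {c : K}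
    (hc : c ≠ 0) : ∃ g ∈ unitaryGroupOfForm σ H, (g : Matrix n n K) *ᵥ x = c • x := by
  obtain ⟨x', hx', hxx'⟩ := exists_hyperbolic_partner_hermForm σ H h2 hσ hH hHd hx hx0
  have hx'x : hermForm σ H x' x = 1 := by rw [← conj_hermForm σ H hσ hH, hxx', map_one]
  have hσc : σ c ≠ 0 := fun h => hc (by simpa [hσ] using congrArg σ h)
  have hαβ : σ ((Units.mk0 c hc : Kˣ) : K) * ((Units.mk0 (σ c) hσc)⁻¹ : Kˣ) = 1 := by
    rw [Units.val_mk0, Units.val_inv_eq_inv_val, Units.val_mk0, mul_inv_cancel₀ hσc]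
  refine ⟨lineDilationGL σ H hx hx' hxx' hx'x (Units.mk0 c hc) (Units.mk0 (σ c) hσc)⁻¹,
    lineDilationGL_mem σ H hσ hH hx hx' hxx' hx'x hαβ, ?_⟩
  rw [coe_lineDilationGL, lineDilation_mulVec_left σ H _ _ hx hx'x, Units.val_mk0]

/-! ## §2 Isotropic vectors that pair non-trivially -/

/-- **`h(x,x) = h(y,y) = 0`, `h(x,y) = 1` ⇒ one quasi-reflection sends `x ↦ y`** (Dieudonné's relation is automatic:
`h(x − y, x) = −1`). [cite: Dieudonne1971GroupesClassiques, Chap. II §4 n° 7–8] -/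
theorem exists_mem_unitaryGroupOfForm_mulVec_eq_of_isotropic_of_pair_eq_one (hσ : ∀ s, σ (σ s) = s)
    (hH : (H.map σ)ᵀ = H) {x y : n → K} (hx : hermForm σ H x x = 0) (hy : hermForm σ H y y = 0)
    (hxy : hermForm σ H x y = 1) : ∃ g ∈ unitaryGroupOfForm σ H, (g : Matrix n n K) *ᵥ x = y := by
  have hxy' : hermForm σ H x x = hermForm σ H y y := by rw [hx, hy]
  have hc : IsUnit (hermForm σ H (x - y) x) := by
    rw [hermForm_sub_left, hx, ← conj_hermForm σ H hσ hH x y, hxy, map_one, zero_sub]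
    exact isUnit_one.neg
  exact exists_mem_unitaryGroupOfForm_mulVec_eq_of_isUnit σ H hσ hH hxy' hc

/-- **two non-zero isotropic vectors with `h(x,y) ≠ 0` are conjugate under `U(σ, H)`** (`H` non-degenerate, `2 ≠ 0`):
`x ↦ y₁ = h(x,y)⁻¹ • y` by one quasi-reflection, then `y₁ ↦ h(x,y) • y₁ = y` by a Levi dilation.
[cite: Dieudonne1971GroupesClassiques, Chap. II §4 n° 7–8] -/
theorem exists_mem_unitaryGroupOfForm_mulVec_eq_of_isotropic_of_ne_zero (h2 : (2 : K) ≠ 0) (hσ : ∀ s, σ (σ s) = s)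
    (hH : (H.map σ)ᵀ = H) (hHd : H.det ≠ 0) {x y : n → K} (hx : hermForm σ H x x = 0) (hy : hermForm σ H y y = 0)
    (hxy : hermForm σ H x y ≠ 0) : ∃ g ∈ unitaryGroupOfForm σ H, (g : Matrix n n K) *ᵥ x = y := by
  set t : K := hermForm σ H x y with ht_def
  -- `y₁ = t⁻¹ • y` is isotropic with `h(x, y₁) = 1`
  have hy₁ : hermForm σ H (t⁻¹ • y) (t⁻¹ • y) = 0 := by
    rw [hermForm_smul_left_eq, hermForm_smul_right, hy, mul_zero, mul_zero]
  have hxy₁ : hermForm σ H x (t⁻¹ • y) = 1 := by rw [hermForm_smul_right, ← ht_def, inv_mul_cancel₀ hxy]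
  obtain ⟨g₁, hg₁, hg₁x⟩ :=
    exists_mem_unitaryGroupOfForm_mulVec_eq_of_isotropic_of_pair_eq_one σ H hσ hH hx hy₁ hxy₁
  -- `y₁ ≠ 0` and the dilation `y₁ ↦ t • y₁ = y`
  have hy₁0 : t⁻¹ • y ≠ 0 := by
    intro h0
    rw [h0, hermForm_zero_right] at hxy₁
    exact one_ne_zero hxy₁.symm
  obtain ⟨g₂, hg₂, hg₂y⟩ := exists_mem_unitaryGroupOfForm_mulVec_eq_smul_of_isotropic σ H h2 hσ hH hHd hy₁ hy₁0 hxy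
  refine ⟨g₂ * g₁, (unitaryGroupOfForm σ H).mul_mem hg₂ hg₁, ?_⟩
  rw [Units.val_mul, ← Matrix.mulVec_mulVec, hg₁x, hg₂y, smul_smul, mul_inv_cancel₀ hxy, one_smul]

/-! ## §3 A common non-orthogonal isotropic vector for two orthogonal isotropic vectors -/

/-- avoiding two values with three candidates: in a field with `2 ≠ 0`, for any `a b` some `μ ∈ {0, 1, −1}` has
`1 + μ a ≠ 0` and `b + μ ≠ 0`. [folklore] -/
private theorem exists_avoid_two (h2 : (2 : K) ≠ 0) (a b : K) : ∃ μ : K, 1 + μ * a ≠ 0 ∧ b + μ ≠ 0 := by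
  by_cases hb : b ≠ 0
  · exact ⟨0, by simp, by simpa using hb⟩
  · rw [not_ne_iff] at hb
    subst hb
    -- `b = 0`: need `μ ≠ 0` with `1 + μ a ≠ 0`; try `μ = 1`, else `μ = −1`
    by_cases h1 : 1 + (1 : K) * a ≠ 0
    · exact ⟨1, h1, by simp⟩
    · rw [not_ne_iff, one_mul] at h1
      refine ⟨-1, ?_, by simp⟩
      intro h
      have ha : a = -1 := by linear_combination h1
      rw [ha] at h
      apply h2
      linear_combination h

/-- **isotropic correction along `x`**: for `h(x,x) = 0` and `c := h(x, z₀) ≠ 0`, the vector `z = z₀ − t • x` with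
`t = h(z₀,z₀) ∕ (2 σ c)` is isotropic and pairs with `x` as `z₀` does. [cite: Dieudonne1971GroupesClassiques, Chap. II §5] -/
theorem exists_isotropic_sub_smul (h2 : (2 : K) ≠ 0) (hσ : ∀ s, σ (σ s) = s) (hH : (H.map σ)ᵀ = H)
    {x z₀ : n → K} (hx : hermForm σ H x x = 0) (hc : hermForm σ H x z₀ ≠ 0) :
    ∃ t : K, hermForm σ H (z₀ - t • x) (z₀ - t • x) = 0 ∧ hermForm σ H x (z₀ - t • x) = hermForm σ H x z₀ := by
  set c : K := hermForm σ H x z₀ with hc_def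
  have hσc : σ c ≠ 0 := fun h => hc (by simpa [hσ] using congrArg σ h)
  have hz₀x : hermForm σ H z₀ x = σ c := (conj_hermForm σ H hσ hH x z₀).symm
  have hqq : σ (hermForm σ H z₀ z₀) = hermForm σ H z₀ z₀ := conj_hermForm_self σ H hσ hH z₀
  have hσ2 : σ 2 = 2 := map_ofNat σ 2
  refine ⟨hermForm σ H z₀ z₀ / (2 * σ c), ?_, ?_⟩
  · simp only [hermForm_sub_left, hermForm_sub_right, hermForm_smul_left_eq, hermForm_smul_right, hx, hz₀x, ← hc_def,
      map_div₀, map_mul, hσ2, hσ, hqq, mul_zero, sub_zero]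
    field_simp
    ring
  · rw [hermForm_sub_right, hermForm_smul_right, hx, mul_zero, sub_zero]

/-- **for non-zero isotropic `x ⊥ y` there is an isotropic `z` with `h(x,z) ≠ 0` and `h(y,z) ≠ 0`** (`H` non-degenerate,
`2 ≠ 0`): take hyperbolic partners `x'`, `y'`, a candidate `z₀ = x' + μ y'` pairing non-trivially with both (`μ` avoids
two values), and correct it along `x` to an isotropic vector. [cite: Dieudonne1971GroupesClassiques, Chap. II §4 n° 7–8] -/
theorem exists_isotropic_not_orth_not_orth (h2 : (2 : K) ≠ 0) (hσ : ∀ s, σ (σ s) = s) (hH : (H.map σ)ᵀ = H)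
    (hHd : H.det ≠ 0) {x y : n → K} (hx : hermForm σ H x x = 0) (hx0 : x ≠ 0) (hy : hermForm σ H y y = 0) (hy0 : y ≠ 0)
    (hxy : hermForm σ H x y = 0) :
    ∃ z : n → K, hermForm σ H z z = 0 ∧ hermForm σ H x z ≠ 0 ∧ hermForm σ H y z ≠ 0 := by
  obtain ⟨x', -, hxx'⟩ := exists_hyperbolic_partner_hermForm σ H h2 hσ hH hHd hx hx0
  obtain ⟨y', -, hyy'⟩ := exists_hyperbolic_partner_hermForm σ H h2 hσ hH hHd hy hy0
  -- choose `μ` with `h(x, x' + μ y') = 1 + μ h(x,y') ≠ 0` and `h(y, x' + μ y') = h(y,x') + μ ≠ 0`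
  obtain ⟨μ, hμ₁, hμ₂⟩ := exists_avoid_two (K := K) h2 (hermForm σ H x y') (hermForm σ H y x')
  set z₀ : n → K := x' + μ • y' with hz₀_def
  have hxz₀ : hermForm σ H x z₀ = 1 + μ * hermForm σ H x y' := by
    rw [hz₀_def, hermForm_add_right, hermForm_smul_right, hxx']
  have hyz₀ : hermForm σ H y z₀ = hermForm σ H y x' + μ := by
    rw [hz₀_def, hermForm_add_right, hermForm_smul_right, hyy', mul_one]
  have hc : hermForm σ H x z₀ ≠ 0 := by rw [hxz₀]; exact hμ₁
  obtain ⟨t, hzz, hxz⟩ := exists_isotropic_sub_smul σ H h2 hσ hH hx hc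
  refine ⟨z₀ - t • x, hzz, by rw [hxz]; exact hc, ?_⟩
  have hyx : hermForm σ H y x = 0 := by rw [← conj_hermForm σ H hσ hH, hxy, map_zero]
  rw [hermForm_sub_right, hermForm_smul_right, hyx, mul_zero, sub_zero, hyz₀]
  exact hμ₂

/-! ## §4 Transitivity on the punctured isotropic cone, and Witt's theorem for lines -/

/-- **TRANSITIVITY OF `U(σ, H)` ON THE PUNCTURED ISOTROPIC CONE**: for a non-degenerate hermitian `H` over a field with
involution and `2 ≠ 0`, any two non-zero isotropic vectors are conjugate under `U(σ, H)` (directly by §2 if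
`h(x,y) ≠ 0`, otherwise `x ↦ z ↦ y` through the `z` of §3). [cite: Dieudonne1971GroupesClassiques, Chap. II §4 n° 7–8]
[cite: Scharlau1985HermitianForms, Ch. 7 §9] -/
theorem exists_mem_unitaryGroupOfForm_mulVec_eq_of_isotropic (h2 : (2 : K) ≠ 0) (hσ : ∀ s, σ (σ s) = s)
    (hH : (H.map σ)ᵀ = H) (hHd : H.det ≠ 0) {x y : n → K} (hx : hermForm σ H x x = 0) (hx0 : x ≠ 0)
    (hy : hermForm σ H y y = 0) (hy0 : y ≠ 0) : ∃ g ∈ unitaryGroupOfForm σ H, (g : Matrix n n K) *ᵥ x = y := by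
  by_cases hxy : hermForm σ H x y ≠ 0
  · exact exists_mem_unitaryGroupOfForm_mulVec_eq_of_isotropic_of_ne_zero σ H h2 hσ hH hHd hx hy hxy
  · rw [not_ne_iff] at hxy
    obtain ⟨z, hz, hxz, hyz⟩ := exists_isotropic_not_orth_not_orth σ H h2 hσ hH hHd hx hx0 hy hy0 hxy
    have hzy : hermForm σ H z y ≠ 0 := by
      rw [← conj_hermForm σ H hσ hH y z]
      exact fun h => hyz (by simpa [hσ] using congrArg σ h)
    obtain ⟨g₁, hg₁, hg₁x⟩ := exists_mem_unitaryGroupOfForm_mulVec_eq_of_isotropic_of_ne_zero σ H h2 hσ hH hHd hx hz hxz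
    obtain ⟨g₂, hg₂, hg₂z⟩ := exists_mem_unitaryGroupOfForm_mulVec_eq_of_isotropic_of_ne_zero σ H h2 hσ hH hHd hz hy hzy
    refine ⟨g₂ * g₁, (unitaryGroupOfForm σ H).mul_mem hg₂ hg₁, ?_⟩
    rw [Units.val_mul, ← Matrix.mulVec_mulVec, hg₁x, hg₂z]

/-- **WITT'S THEOREM FOR LINES OF A NON-DEGENERATE HERMITIAN SPACE**: over a field with involution and `2 ≠ 0`, two
non-zero vectors of the same length `h(x,x) = h(y,y)` (isotropic or not) are conjugate under `U(σ, H)`; i.e. for every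
`i`, the set `U(i) = {x ≠ 0 : h(x,x) = i}` is a single `U(σ,H)`-orbit — Weil's transitivity hypothesis at the auxiliary
place for `G'_v = G_v`, rank one. [cite: Dieudonne1971GroupesClassiques, Chap. II §4 n° 7–8] [cite: Scharlau1985HermitianForms, Ch. 7 §9]
[cite: Weil1965, n° 52 Thm. 5] -/
theorem exists_mem_unitaryGroupOfForm_mulVec_eq_of_ne_zero (h2 : (2 : K) ≠ 0) (hσ : ∀ s, σ (σ s) = s)
    (hH : (H.map σ)ᵀ = H) (hHd : H.det ≠ 0) {x y : n → K} (hx0 : x ≠ 0) (hy0 : y ≠ 0)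
    (hxy : hermForm σ H x x = hermForm σ H y y) : ∃ g ∈ unitaryGroupOfForm σ H, (g : Matrix n n K) *ᵥ x = y := by
  by_cases hβ : hermForm σ H x x = 0
  · exact exists_mem_unitaryGroupOfForm_mulVec_eq_of_isotropic σ H h2 hσ hH hHd hβ hx0 (hxy ▸ hβ) hy0
  · exact exists_mem_unitaryGroupOfForm_mulVec_eq σ H hσ hH h2 rfl hxy.symm hβ

/-- **Orbit form on non-zero vectors**: `y ∈ U(σ,H) · x ↔ h(y,y) = h(x,x)` for `x, y ≠ 0` (`H` non-degenerate, `2 ≠ 0`).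
[cite: Dieudonne1971GroupesClassiques, Chap. II §4 n° 7–8] [cite: Scharlau1985HermitianForms, Ch. 7 §9] -/
theorem exists_mem_unitaryGroupOfForm_mulVec_eq_iff_of_ne_zero (h2 : (2 : K) ≠ 0) (hσ : ∀ s, σ (σ s) = s)
    (hH : (H.map σ)ᵀ = H) (hHd : H.det ≠ 0) {x y : n → K} (hx0 : x ≠ 0) (hy0 : y ≠ 0) :
    (∃ g ∈ unitaryGroupOfForm σ H, (g : Matrix n n K) *ᵥ x = y) ↔ hermForm σ H y y = hermForm σ H x x := by
  constructor
  · rintro ⟨g, hg, rfl⟩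
    exact (mem_unitaryGroupOfForm_iff_hermForm σ H g).1 hg x x
  · intro hyx
    exact exists_mem_unitaryGroupOfForm_mulVec_eq_of_ne_zero σ H h2 hσ hH hHd hx0 hy0 hyx.symm

end Literature.NumberTheory.Automorphic.UnitaryGroup
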